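import Mathlib
import Summits.ValiantsHypothesis.ValiantsHypothesis.Theorems.NewtonUnitEquationsDissociatedUniformTotalsLaw
import Summits.ValiantsHypothesis.ValiantsHypothesis.Theorems.NewtonUnitEquationsDissociatedUniformTotalsLawUnion
import Summits.ValiantsHypothesis.ValiantsHypothesis.Theorems.NewtonUnitEquationsDissociatedUniformTotalsLawFibreDepthSets
import Summits.ValiantsHypothesis.ValiantsHypothesis.Theorems.NewtonUnitEquationsDissociatedUniformTotalsLawDepthCells
import Summits.ValiantsHypothesis.ValiantsHypothesis.Theorems.NewtonUnitEquationsDissociatedUniformTotalsLawAverageUnion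
import Literature.Computability.AlgebraicComplexity.NewtonPolygonTauProductBounds
import HarnessLib

/-!
# Crux `NewtonUnitEquations.DissociatedUniform` (stmt-ValiantsHypothesis-5905): the `n = 3` totals law — the DEPTH-SET CERTIFICATE for a FIXED position set (reduction of `UnionTotalsLaw(Z)` to translate-avoidance counts)

Deterministic companion of the average union law (`…TotalsLawAverageUnion`; memo `Cruxes/DissociatedUniform/NOTES-t1g12.md` §2–§3, §6(iii)).
For a FIXED position set `Z ⊆ G` the same certificate gives an exact-shape reduction: a chart top `v` of `U_s(Z) = ⋃_{r ∈ s - Z} P_r` has its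
above-fibre set `F = aboveFib σ t v` (realised off any finite time set `T`) disjoint from `s - Z`, i.e. the class `s` AVOIDS `F + Z`.  Hence

  `∑_s #tops_σ(U_s(Z)) ≤ ∑_{v ∈ A+B} ∑_{F ∈ depthSetsOff σ T v} N_Z(F)`,   `N_Z(F) := #{s : s - f ∉ Z for all f ∈ F} = |G ∖ (F + Z)|`

(`sum_card_topsAlong_image_le_sum_avoid`), and `unionTotal a b Z ≤` the same sums over both half-charts (`unionTotal_le_sum_avoid`): the union
totals law for `Z` is reduced to an ADDITIVE-COMBINATORIAL quantity — how many translates of `Z` avoid the realised depth sets `F` of the pair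
system — weighted against the GEOMETRIC multiplicities, for which `∑_{(v,F)} 2^{|G| - #F} ≤ 792000·|G|·2^{|G|}` (`sum_depthSets_pow_le`, from
`…TotalsLawDepthCells`).  So `Z = G` (`N = [F = ∅]`), uniformly random `Z` (`E N_Z(F) = |G|2^{-#F}`: the average law) and any `Z` with
`2^{#F}·N_Z(F) ≤ K|G|` ON THE REALISED depth sets (`unionTotal_le_of_avoid_bound`: `UT ≤ 1584000·K·|G|²`) are covered.  CAUTION (recorded so
that nobody types the vacuous version): demanding `2^{#F}·N_Z(F) ≤ K|G|` for ALL finite `F` forces `Z` to be co-logarithmic (take `F` inside a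
translate of the complement), so the hypothesis must be restricted to the realised family; intervals `Z = [0, m)` are the located open case.
APPENDED (same session): the REFINED certificate `unionTotal_le_sum_avoid'` keeping the carrying fibre (`s - r ∈ Z` for some fibre `r ∋ v`),
which is the form needed for structured `Z` (for an interval each `(v, F, r)` is charged `≤ #Z` classes, and none unless the labels of the
fibres above `v` leave a gap `> #Z` around `r`).
Honest label: `UnionTotalsLaw C` (every `Z`), `UnionVertBound`, `TotalsLawThree` remain OPEN; nothing here bears on VP ≠ VNP.
[folklore: levels in arrangements; covering by translates]
-/

set_option linter.dupNamespace false -- `ValiantsHypothesis.ValiantsHypothesis` (summit = problem) in every name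

open scoped BigOperators Pointwise
open Matrix Finset

namespace Summit.ValiantsHypothesis.ValiantsHypothesis.Theorems.NewtonUnitEquationsDissociatedUniform

namespace TotalsLaw

open Literature.Computability.AlgebraicComplexity.KPTT.PlanarMinkowski

section Certificate

variable {G : Type*} [AddCommGroup G] [Fintype G] [DecidableEq G]

/-- **The level-weighted depth-pair sum** (extracted from `…TotalsLawAverageUnion.sum_card_topsAlong_le`): with `T` the union of the
low-event time sets `lowTimes_j`, `j ≤ |G|`, `∑_{v ∈ A+B} ∑_{F ∈ depthSetsOff(v)} 2^{|G| - #F} ≤ 792000·|G|·2^{|G|}`. [folklore] -/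
theorem sum_depthSets_pow_le (a b : G → (Fin 2 → ℝ)) {σ : ℝ} (hσ : σ ≠ 0) :
    ∑ v ∈ sumFin a b, ∑ F ∈ depthSetsOff a b σ
        ((Finset.range (Fintype.card G + 1)).biUnion fun j => lowTimes a b σ j) v, 2 ^ (Fintype.card G - F.card) ≤
      792000 * Fintype.card G * 2 ^ Fintype.card G := by
  classical
  set q := Fintype.card G with hq
  have hq1 : 1 ≤ q := Fintype.card_pos
  set T : Finset ℝ := (Finset.range (q + 1)).biUnion fun j => lowTimes a b σ j with hT
  have hTj : ∀ j ∈ Finset.range (q + 1), lowTimes a b σ j ⊆ T := fun j hj =>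
    Finset.subset_biUnion_of_mem (fun j => lowTimes a b σ j) hj
  calc ∑ v ∈ sumFin a b, ∑ F ∈ depthSetsOff a b σ T v, 2 ^ (q - F.card)
      ≤ ∑ j ∈ Finset.range (q + 1), 2 ^ (q - j) * (depthPairs a b σ j T).card := sum_sum_pow_le a b σ T
    _ ≤ ∑ j ∈ Finset.range (q + 1), 2 ^ (q - j) * (66 * q * (j + 1) ^ 5) :=
        Finset.sum_le_sum fun j hj => Nat.mul_le_mul_left _
          ((card_depthPairs_le_poly a b hσ j T (hTj j hj)).trans (depthPoly_le hq1 j))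
    _ = 66 * q * ∑ j ∈ Finset.range (q + 1), 2 ^ (q - j) * (j + 1) ^ 5 := by
        rw [Finset.mul_sum]
        exact Finset.sum_congr rfl fun j _ => by ring
    _ ≤ 66 * q * (12000 * 2 ^ q) := Nat.mul_le_mul_left _ (sum_two_pow_sub_mul_pow_five_le q)
    _ = 792000 * q * 2 ^ q := by ring

/-- **Certificate for a fixed position set.**  The classes `s` for which `v` is a chart top of `U_s(Z)` all avoid `F + Z` for some depth
set `F` of `v` realised off `T`: `#{s : v ∈ tops_σ(U_s(Z))} ≤ ∑_{F} N_Z(F)`, `N_Z(F) = #{s : ∀ f ∈ F, s - f ∉ Z}`. [folklore] -/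
theorem card_filter_mem_topsAlong_image_le (a b : G → (Fin 2 → ℝ)) (σ : ℝ) (T : Finset ℝ) (Z : Finset G) (v : Fin 2 → ℝ) :
    ((Finset.univ : Finset G).filter fun s => v ∈ topsAlong a b σ (Z.image fun z => s - z)).card ≤
      ∑ F ∈ depthSetsOff a b σ T v, ((Finset.univ : Finset G).filter fun s => ∀ f ∈ F, s - f ∉ Z).card := by
  classical
  have hsub : ((Finset.univ : Finset G).filter fun s => v ∈ topsAlong a b σ (Z.image fun z => s - z)) ⊆
      (depthSetsOff a b σ T v).biUnion fun F => (Finset.univ : Finset G).filter fun s => ∀ f ∈ F, s - f ∉ Z := by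
    intro s hs
    obtain ⟨-, hv⟩ := Finset.mem_filter.1 hs
    obtain ⟨t, htT, htop⟩ := exists_isStrictTop_not_mem hv T
    rw [Finset.mem_biUnion]
    refine ⟨aboveFib a b σ t v, ?_, Finset.mem_filter.2 ⟨Finset.mem_univ _, fun f hf hfZ => ?_⟩⟩
    · unfold depthSetsOff
      exact Finset.mem_filter.2 ⟨Finset.mem_powerset.2 (Finset.subset_univ _), t, htT, rfl⟩
    · have hfR : f ∈ Z.image fun z => s - z := Finset.mem_image.2 ⟨s - f, hfZ, by abel⟩
      exact not_mem_aboveFib_of_isStrictTop htop hfR hf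
  exact (Finset.card_le_card hsub).trans Finset.card_biUnion_le

/-- **Reduction, per half-chart**: `∑_s #tops_σ(U_s(Z)) ≤ ∑_{v ∈ A+B} ∑_{F ∈ depthSetsOff σ T v} N_Z(F)` for every finite time set `T`. [folklore] -/
theorem sum_card_topsAlong_image_le_sum_avoid (a b : G → (Fin 2 → ℝ)) (σ : ℝ) (T : Finset ℝ) (Z : Finset G) :
    ∑ s : G, (topsAlong a b σ (Z.image fun z => s - z)).card ≤
      ∑ v ∈ sumFin a b, ∑ F ∈ depthSetsOff a b σ T v, ((Finset.univ : Finset G).filter fun s => ∀ f ∈ F, s - f ∉ Z).card := by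
  classical
  have h1 : ∀ s : G, (topsAlong a b σ (Z.image fun z => s - z)).card =
      ∑ v ∈ sumFin a b, if v ∈ topsAlong a b σ (Z.image fun z => s - z) then 1 else 0 := by
    intro s
    rw [Finset.sum_boole, Finset.filter_mem_eq_inter, Finset.inter_eq_right.2 (topsAlong_subset_sumFin a b σ _)]
    simp
  have h2 : ∀ v : Fin 2 → ℝ, ((Finset.univ : Finset G).filter fun s => v ∈ topsAlong a b σ (Z.image fun z => s - z)).card =
      ∑ s : G, if v ∈ topsAlong a b σ (Z.image fun z => s - z) then 1 else 0 := by
    intro v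
    rw [Finset.sum_boole]
    simp
  calc ∑ s : G, (topsAlong a b σ (Z.image fun z => s - z)).card
      = ∑ v ∈ sumFin a b, ((Finset.univ : Finset G).filter fun s => v ∈ topsAlong a b σ (Z.image fun z => s - z)).card := by
        simp_rw [h1, h2]; exact Finset.sum_comm
    _ ≤ _ := Finset.sum_le_sum fun v _ => card_filter_mem_topsAlong_image_le a b σ T Z v

/-- **THE DEPTH-SET CERTIFICATE FOR `UnionTotalsLaw(Z)`**: for every finite time set `T`,
`unionTotal a b Z ≤ ∑_{σ = ±1} ∑_{v ∈ A+B} ∑_{F ∈ depthSetsOff σ T v} N_Z(F)` — the union total of a FIXED position set is at most the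
number of (half-chart, point, realised depth set, translate of `Z` avoiding the depth set) incidences. [folklore] -/
theorem unionTotal_le_sum_avoid (a b : G → (Fin 2 → ℝ)) (Z : Finset G) (T₁ T₂ : Finset ℝ) :
    unionTotal a b (Z : Set G) ≤
      ∑ v ∈ sumFin a b, ∑ F ∈ depthSetsOff a b 1 T₁ v, ((Finset.univ : Finset G).filter fun s => ∀ f ∈ F, s - f ∉ Z).card +
      ∑ v ∈ sumFin a b, ∑ F ∈ depthSetsOff a b (-1) T₂ v, ((Finset.univ : Finset G).filter fun s => ∀ f ∈ F, s - f ∉ Z).card := by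
  unfold unionTotal
  calc ∑ s, unionVert a b (Z : Set G) s
      ≤ ∑ s : G, ((topsAlong a b 1 (Z.image fun z => s - z)).card + (topsAlong a b (-1) (Z.image fun z => s - z)).card) :=
        Finset.sum_le_sum fun s _ => by
          rw [unionVert_eq_ncard_unionFib]
          exact ncard_extremePoints_unionFib_le a b _
    _ = ∑ s : G, (topsAlong a b 1 (Z.image fun z => s - z)).card + ∑ s : G, (topsAlong a b (-1) (Z.image fun z => s - z)).card :=
        Finset.sum_add_distrib
    _ ≤ _ := add_le_add (sum_card_topsAlong_image_le_sum_avoid a b 1 T₁ Z) (sum_card_topsAlong_image_le_sum_avoid a b (-1) T₂ Z)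

/-- **Avoidance bound on the realised depth sets ⇒ `UnionTotalsLaw(Z)`.**  If along both half-charts every REALISED depth set `F` (off the
low-event times) satisfies `2^{#F}·N_Z(F) ≤ K·|G|`, then `unionTotal a b Z ≤ 1584000·K·|G|²`.  (The hypothesis is on the geometric family of
realised depth sets, not on all finite `F` — see the caution in the module docstring.) [folklore] -/
theorem unionTotal_le_of_avoid_bound (a b : G → (Fin 2 → ℝ)) (Z : Finset G) {K : ℕ}
    (hZ : ∀ σ : ℝ, σ = 1 ∨ σ = -1 → ∀ v ∈ sumFin a b, ∀ F ∈ depthSetsOff a b σ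
        ((Finset.range (Fintype.card G + 1)).biUnion fun j => lowTimes a b σ j) v,
        2 ^ F.card * ((Finset.univ : Finset G).filter fun s => ∀ f ∈ F, s - f ∉ Z).card ≤ K * Fintype.card G) :
    unionTotal a b (Z : Set G) ≤ 1584000 * K * Fintype.card G ^ 2 := by
  classical
  set q := Fintype.card G with hq
  -- per half-chart bound
  have hchart : ∀ σ : ℝ, σ ≠ 0 → (σ = 1 ∨ σ = -1) →
      ∑ v ∈ sumFin a b, ∑ F ∈ depthSetsOff a b σ ((Finset.range (q + 1)).biUnion fun j => lowTimes a b σ j) v,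
        ((Finset.univ : Finset G).filter fun s => ∀ f ∈ F, s - f ∉ Z).card ≤ 792000 * K * q ^ 2 := by
    intro σ hσ hσ1
    set T : Finset ℝ := (Finset.range (q + 1)).biUnion fun j => lowTimes a b σ j with hT
    have hF : ∀ v ∈ sumFin a b, ∀ F ∈ depthSetsOff a b σ T v,
        2 ^ q * ((Finset.univ : Finset G).filter fun s => ∀ f ∈ F, s - f ∉ Z).card ≤ K * q * 2 ^ (q - F.card) := by
      intro v hv F hFm
      have hle : F.card ≤ q := by rw [hq, ← Finset.card_univ]; exact Finset.card_le_univ _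
      have hsplit : 2 ^ q = 2 ^ (q - F.card) * 2 ^ F.card := by rw [← pow_add, Nat.sub_add_cancel hle]
      calc 2 ^ q * ((Finset.univ : Finset G).filter fun s => ∀ f ∈ F, s - f ∉ Z).card
          = 2 ^ (q - F.card) * (2 ^ F.card * ((Finset.univ : Finset G).filter fun s => ∀ f ∈ F, s - f ∉ Z).card) := by
            rw [hsplit]; ring
        _ ≤ 2 ^ (q - F.card) * (K * q) := Nat.mul_le_mul_left _ (hZ σ hσ1 v hv F hFm)
        _ = K * q * 2 ^ (q - F.card) := by ring
    have key : 2 ^ q * ∑ v ∈ sumFin a b, ∑ F ∈ depthSetsOff a b σ T v,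
        ((Finset.univ : Finset G).filter fun s => ∀ f ∈ F, s - f ∉ Z).card ≤ 2 ^ q * (792000 * K * q ^ 2) := by
      calc 2 ^ q * ∑ v ∈ sumFin a b, ∑ F ∈ depthSetsOff a b σ T v,
            ((Finset.univ : Finset G).filter fun s => ∀ f ∈ F, s - f ∉ Z).card
          = ∑ v ∈ sumFin a b, ∑ F ∈ depthSetsOff a b σ T v,
              2 ^ q * ((Finset.univ : Finset G).filter fun s => ∀ f ∈ F, s - f ∉ Z).card := by
            rw [Finset.mul_sum]
            exact Finset.sum_congr rfl fun v _ => Finset.mul_sum _ _ _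
        _ ≤ ∑ v ∈ sumFin a b, ∑ F ∈ depthSetsOff a b σ T v, K * q * 2 ^ (q - F.card) :=
            Finset.sum_le_sum fun v hv => Finset.sum_le_sum fun F hFm => hF v hv F hFm
        _ = K * q * ∑ v ∈ sumFin a b, ∑ F ∈ depthSetsOff a b σ T v, 2 ^ (q - F.card) := by
            rw [Finset.mul_sum]
            exact Finset.sum_congr rfl fun v _ => (Finset.mul_sum _ _ _).symm
        _ ≤ K * q * (792000 * q * 2 ^ q) := Nat.mul_le_mul_left _ (sum_depthSets_pow_le a b hσ)
        _ = 2 ^ q * (792000 * K * q ^ 2) := by ring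
    exact Nat.le_of_mul_le_mul_left key (pow_pos two_pos q)
  calc unionTotal a b (Z : Set G) ≤ _ := unionTotal_le_sum_avoid a b Z
        ((Finset.range (q + 1)).biUnion fun j => lowTimes a b 1 j) ((Finset.range (q + 1)).biUnion fun j => lowTimes a b (-1) j)
    _ ≤ 792000 * K * q ^ 2 + 792000 * K * q ^ 2 :=
        add_le_add (hchart 1 one_ne_zero (Or.inl rfl)) (hchart (-1) (by norm_num) (Or.inr rfl))
    _ = 1584000 * K * q ^ 2 := by ring

/-! ### The refined certificate (keeping the carrying fibre): the tool for structured position sets -/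

/-- **Refined certificate.**  The classes `s` for which `v` is a chart top of `U_s(Z)` satisfy, for some depth set `F` of `v` realised off `T`:
some fibre `r` through `v` lies in `s - Z` AND `s` avoids `F + Z`.  (For an interval `Z` this caps the count per `(v, F, r)` by `#Z` and makes
it vanish unless the labels of the fibres above `v` leave a gap of length `> #Z` around `r` — memo NOTES-t1g12 §6(iii).) [folklore] -/
theorem card_filter_mem_topsAlong_image_le' (a b : G → (Fin 2 → ℝ)) (σ : ℝ) (T : Finset ℝ) (Z : Finset G) (v : Fin 2 → ℝ) :
    ((Finset.univ : Finset G).filter fun s => v ∈ topsAlong a b σ (Z.image fun z => s - z)).card ≤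
      ∑ F ∈ depthSetsOff a b σ T v, ((Finset.univ : Finset G).filter fun s =>
        (∃ r : G, v ∈ fibFin a b r ∧ s - r ∈ Z) ∧ ∀ f ∈ F, s - f ∉ Z).card := by
  classical
  have hsub : ((Finset.univ : Finset G).filter fun s => v ∈ topsAlong a b σ (Z.image fun z => s - z)) ⊆
      (depthSetsOff a b σ T v).biUnion fun F => (Finset.univ : Finset G).filter fun s =>
        (∃ r : G, v ∈ fibFin a b r ∧ s - r ∈ Z) ∧ ∀ f ∈ F, s - f ∉ Z := by
    intro s hs
    obtain ⟨-, hv⟩ := Finset.mem_filter.1 hs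
    obtain ⟨t, htT, htop⟩ := exists_isStrictTop_not_mem hv T
    rw [Finset.mem_biUnion]
    refine ⟨aboveFib a b σ t v, ?_, Finset.mem_filter.2 ⟨Finset.mem_univ _, ?_, fun f hf hfZ => ?_⟩⟩
    · unfold depthSetsOff
      exact Finset.mem_filter.2 ⟨Finset.mem_powerset.2 (Finset.subset_univ _), t, htT, rfl⟩
    · obtain ⟨r, hr, hvr⟩ := mem_unionFib.1 htop.mem
      obtain ⟨z, hz, rfl⟩ := Finset.mem_image.1 hr
      exact ⟨s - z, hvr, by rwa [show s - (s - z) = z by abel]⟩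
    · have hfR : f ∈ Z.image fun z => s - z := Finset.mem_image.2 ⟨s - f, hfZ, by abel⟩
      exact not_mem_aboveFib_of_isStrictTop htop hfR hf
  exact (Finset.card_le_card hsub).trans Finset.card_biUnion_le

/-- **Refined reduction, per half-chart.** [folklore] -/
theorem sum_card_topsAlong_image_le_sum_avoid' (a b : G → (Fin 2 → ℝ)) (σ : ℝ) (T : Finset ℝ) (Z : Finset G) :
    ∑ s : G, (topsAlong a b σ (Z.image fun z => s - z)).card ≤
      ∑ v ∈ sumFin a b, ∑ F ∈ depthSetsOff a b σ T v, ((Finset.univ : Finset G).filter fun s =>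
        (∃ r : G, v ∈ fibFin a b r ∧ s - r ∈ Z) ∧ ∀ f ∈ F, s - f ∉ Z).card := by
  classical
  have h1 : ∀ s : G, (topsAlong a b σ (Z.image fun z => s - z)).card =
      ∑ v ∈ sumFin a b, if v ∈ topsAlong a b σ (Z.image fun z => s - z) then 1 else 0 := by
    intro s
    rw [Finset.sum_boole, Finset.filter_mem_eq_inter, Finset.inter_eq_right.2 (topsAlong_subset_sumFin a b σ _)]
    simp
  have h2 : ∀ v : Fin 2 → ℝ, ((Finset.univ : Finset G).filter fun s => v ∈ topsAlong a b σ (Z.image fun z => s - z)).card =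
      ∑ s : G, if v ∈ topsAlong a b σ (Z.image fun z => s - z) then 1 else 0 := by
    intro v
    rw [Finset.sum_boole]
    simp
  calc ∑ s : G, (topsAlong a b σ (Z.image fun z => s - z)).card
      = ∑ v ∈ sumFin a b, ((Finset.univ : Finset G).filter fun s => v ∈ topsAlong a b σ (Z.image fun z => s - z)).card := by
        simp_rw [h1, h2]; exact Finset.sum_comm
    _ ≤ _ := Finset.sum_le_sum fun v _ => card_filter_mem_topsAlong_image_le' a b σ T Z v

/-- **THE REFINED DEPTH-SET CERTIFICATE FOR `UnionTotalsLaw(Z)`** (both half-charts, any finite `T₁, T₂`): `unionTotal a b Z` is at most the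
number of incidences (half-chart `σ`, point `v ∈ A+B`, realised depth set `F` of `v`, class `s`) with `s - r ∈ Z` for a fibre `r ∋ v` and
`s - f ∉ Z` for all `f ∈ F`. [folklore] -/
theorem unionTotal_le_sum_avoid' (a b : G → (Fin 2 → ℝ)) (Z : Finset G) (T₁ T₂ : Finset ℝ) :
    unionTotal a b (Z : Set G) ≤
      ∑ v ∈ sumFin a b, ∑ F ∈ depthSetsOff a b 1 T₁ v, ((Finset.univ : Finset G).filter fun s =>
        (∃ r : G, v ∈ fibFin a b r ∧ s - r ∈ Z) ∧ ∀ f ∈ F, s - f ∉ Z).card +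
      ∑ v ∈ sumFin a b, ∑ F ∈ depthSetsOff a b (-1) T₂ v, ((Finset.univ : Finset G).filter fun s =>
        (∃ r : G, v ∈ fibFin a b r ∧ s - r ∈ Z) ∧ ∀ f ∈ F, s - f ∉ Z).card := by
  unfold unionTotal
  calc ∑ s, unionVert a b (Z : Set G) s
      ≤ ∑ s : G, ((topsAlong a b 1 (Z.image fun z => s - z)).card + (topsAlong a b (-1) (Z.image fun z => s - z)).card) :=
        Finset.sum_le_sum fun s _ => by
          rw [unionVert_eq_ncard_unionFib]
          exact ncard_extremePoints_unionFib_le a b _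
    _ = ∑ s : G, (topsAlong a b 1 (Z.image fun z => s - z)).card + ∑ s : G, (topsAlong a b (-1) (Z.image fun z => s - z)).card :=
        Finset.sum_add_distrib
    _ ≤ _ := add_le_add (sum_card_topsAlong_image_le_sum_avoid' a b 1 T₁ Z) (sum_card_topsAlong_image_le_sum_avoid' a b (-1) T₂ Z)

/-! ### Why the avoidance hypothesis must be restricted to the realised depth sets -/

/-- **The all-`F` avoidance hypothesis is vacuous (forces `Z` co-logarithmic).**  If `2^{#F}·#{s : ∀ f ∈ F, s - f ∉ Z} ≤ K·|G|` for EVERY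
finite `F ⊆ G`, then `2^{|G ∖ Z|} ≤ K·|G|`: take `F = -(G ∖ Z)`, for which the class `s = 0` avoids `F + Z`.  So only position sets missing
at most `log₂(K|G|)` positions qualify — the co-small stratum already covered by `…TotalsLawExposure`; this is why `unionTotal_le_of_avoid_bound`
quantifies over the realised depth sets only. [folklore] -/
theorem two_pow_card_compl_le_of_avoid_all (Z : Finset G) {K : ℕ}
    (hZ : ∀ F : Finset G, 2 ^ F.card * ((Finset.univ : Finset G).filter fun s => ∀ f ∈ F, s - f ∉ Z).card ≤ K * Fintype.card G) :
    2 ^ ((Finset.univ : Finset G) \ Z).card ≤ K * Fintype.card G := by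
  classical
  set F : Finset G := ((Finset.univ : Finset G) \ Z).image fun w => -w with hF
  have hFcard : F.card = ((Finset.univ : Finset G) \ Z).card :=
    Finset.card_image_of_injective _ neg_injective
  have h0 : (0 : G) ∈ (Finset.univ : Finset G).filter fun s => ∀ f ∈ F, s - f ∉ Z := by
    refine Finset.mem_filter.2 ⟨Finset.mem_univ _, fun f hf => ?_⟩
    obtain ⟨w, hw, rfl⟩ := Finset.mem_image.1 hf
    rw [zero_sub, neg_neg]
    exact (Finset.mem_sdiff.1 hw).2
  have h1 : 1 ≤ ((Finset.univ : Finset G).filter fun s => ∀ f ∈ F, s - f ∉ Z).card :=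
    Finset.card_pos.2 ⟨0, h0⟩
  calc 2 ^ ((Finset.univ : Finset G) \ Z).card = 2 ^ F.card * 1 := by rw [hFcard, mul_one]
    _ ≤ 2 ^ F.card * ((Finset.univ : Finset G).filter fun s => ∀ f ∈ F, s - f ∉ Z).card := Nat.mul_le_mul_left _ h1
    _ ≤ K * Fintype.card G := hZ F

end Certificate

end TotalsLaw

end Summit.ValiantsHypothesis.ValiantsHypothesis.Theorems.NewtonUnitEquationsDissociatedUniform
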